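import Summits.AtomisticToContinuum.HydrodynamicLimit.Theses.KickedOrbits
import HarnessLib

/-!
# Birth skeleton (BC3) for crux `QuenchedThermalHydro` — item stmt-AtomisticToContinuum-13139,
# route `KickedOrbits` (the route's X, auto-crux rank 0), sub-problem `HydrodynamicLimit`

Crux BY NAME: `Summit.AtomisticToContinuum.HydrodynamicLimit.Theses.KickedOrbits.QuenchedThermalHydro` (X,
QUENCHED THERMAL HYDRODYNAMICS): `∃ η₁ > 0 ∀ σ > 0`, for every classical hs-Euler solution `(ρ,u,θ)` on
`[0,T)` with `ρσ³ ≤ η₁`, every flow family `Φ`, EVERY position sequence `q_N` whose Maxwellian fibre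
`velMeasure (u 0) (θ 0) (q N)` is a.e. good and whose empirical density converges to `ρ(0,·)dx`, the
QUENCHED LAW `P^q_N := (velMeasure (u 0) (θ 0) (q N)).map (zipConfig (q N, ·))` (positions frozen at
`q_N`, velocities drawn ONCE, independently, from the local Maxwellians, dynamics deterministic) has
hydrodynamic fields converging in probability: `TendstoHydroFieldsAt P^q Φ ρ u θ t` for `0 < t < T`.

## The cut: X = MEAN ⊕ FLUCTUATION (line `birth`)

Convergence in `P^q_N`-probability of the tested fields `F = ⟨χ, ρ_N(t)⟩, ⟨χ, m_N(t)⟩, ⟨χ, e_N(t)⟩` to the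
Euler values is split at its canonical centring, the quenched MEAN `E_{P^q_N} F`, into two statements
with different microscopic content, each stated in X's OWN frame verbatim (same prefix `∃ η₁ > 0 ∀ σ > 0
… ∀ q …`, same hypotheses, same times `t ∈ Ioo 0 T`, only the conclusion changes):

* `stub_quenchedMeanHydro` (M) — QUENCHED HYDRODYNAMICS IN THE MEAN: the Bochner means
  `∫ F dP^q_N` of the three tested fields at time `t` converge to `∫χρ_t`, `∫χρ_t u_t`, `∫χE_t`.
  Content: the law-averaged one-body functional obeys Bogolyubov's EXACT mean balance law (free
  streaming + collisional transfer; pathwise identity landed as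
  `Theorems.ChaosClosesEulerWeakEquation.stub_weakEquation`), so (M) is ONE-BODY (local-Maxwellian
  moments) + TWO-BODY (contact / virial value `ρθ(Z−1)`) CLOSURE IN THE QUENCHED MEAN along the
  classical solution — the quenched twin of crux `MirrorJeffreys.ForwardMeanHydro` (stmt-17767, whose
  registered line `Cruxes/ForwardMeanHydro/Lines/birth.lean` is the template: meanBalanceLaw /
  kineticFluxClosure / collisionalTransferClosure / eulerWeakForm / continuousTiltExtension, with
  `localGibbsLaw` replaced by `P^q_N`; the t = 0 means are EXPLICIT here: `E m̂(0) = (N+1)⁻¹Σχ(qᵢ)u(0,qᵢ)`,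
  density typicality applied to the continuous `χ·u(0,·)`). This is where X's "no kick-proof POSITION
  pathology" lives: mesoscale jammed grains / sheets in an admissible `q` would shift the MEAN fluxes.
  Why it might fail: exactly X's why-might-fail (position pathologies inside the band), now visible
  at first order; integrability of `F` under `P^q_N` (bounded resp. dominated by the conserved kinetic
  energy, Gaussian at time 0) is part of the stub's burden (typing checklist 4c(ii): the integrand is
  a fixed, a.e.-dominated function — no junk-zero vacuity, but the prover must show it). Size: open
  problem (XL); strictly WEAKER than X given uniform integrability (X ∧ UI ⇒ M), not conversely.
* `stub_quenchedSelfAveraging` (C) — QUENCHED SELF-AVERAGING (zero-variance law, pre-shock): for every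
  `δ > 0`, `P^q_N{δ < |F − E_{P^q_N}F|} → 0` for the three fields. No identification of any limit.
  Content: the macroscopic state at Euler time `t` is a function of `N+1` INDEPENDENT velocity draws
  (positions are frozen) — the one structural feature the quenched law has and the local Gibbs law
  (hard-core-correlated positions) lacks — so (C) is an INFLUENCE statement: by Efron–Stein,
  `Var F ≤ ½ Σᵢ E(F − F⁽ⁱ⁾)²`, `F⁽ⁱ⁾` = resample sphere i's initial velocity; (C) follows once resampling
  ONE initial velocity moves `⟨χ, field(t)⟩` by `o((N+1)^{-1/2})` in quenched `L²`, averaged over i —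
  the route's "velocity randomness defeats steering" thesis in its sharpest checkable form (cf. the
  board's influence / variance programmes: `OneParticleInfluence`, `ResamplingInfluence`,
  `VitaliAmplitudeTransfer.FieldVarianceBound` (stmt-11872: `(N+1)·Var = O(1)` pre-shock for LOCAL GIBBS
  laws), and the NEGATIVE post-shock side `AnnealedZeroHorizon.ZeroHorizonSpread` (stmt-9255), which is
  `¬`(C) for the annealed law AFTER the shock — the reason (C) keeps X's pre-shock frame `t < T` and the
  packing guard instead of an Euler-free `∀ t > 0`). Why it might fail: a Lyapunov cascade amplifying
  ONE resampled velocity to an `O(1)` change of a macroscopic observable before `T` with probability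
  `≳ (N+1)^{-1}` (spontaneous stochasticity born pre-shock at a slip surface of positive width), or
  steering-type bad sets of non-vanishing `P^q_N`-measure around special admissible `q`. Size: open
  problem (XL); NOT implied by X (X centres at the Euler value, (C) at the mean: X ⇒ C needs UI, C ⇒ X
  needs M).

Composition `QuenchedThermalHydro_of` (REAL proof, no `sorry`; hypotheses = the two stub statements BY
STUB NAME through the `__Registered.stub_*` aliases, device of `Cruxes/ForwardMeanHydro/Lines/birth.lean`):
`η₁ := min η₁ᴹ η₁ᶜ` (the guard is monotone), then per `(χ, δ)`: means → Euler value (M) and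
concentration at `δ/2` around the means (C) give `P^q_N{δ < |F − Euler value|} → 0` by the triangle
inequality, eventually in `N` (`tendsto_measure_abs_sub_of_centre` / `…_norm_…`, proved below), i.e.
`TendstoHydroFieldsAt P^q Φ ρ u θ t` definitionally. The closing `example` feeds the two sorried stubs in.

WHY THIS CUT (rejected alternatives). (i) "t = 0 LLN + propagation for quenched laws": under `P^q_N`
the density field at `t = 0` is DETERMINISTIC, so `TendstoHydroFieldsAt P^q … 0` is density typicality
again and the propagation half is X reworded (costume). (ii) "law-generic propagation" (any law that is
Maxwellian given its position marginal): equivalent to X by the diagonal/Markov extraction of the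
route's own `QuenchedToAnnealed` plan (costume). (iii) `KickedMicrostateHydro` at `η ≡ 1` +
`KickedImpliesQuenched`: the first is X with a decorative velocity coordinate (costume; and a stronger
open item of the same route). (iv) BF18 relative-energy cut (quenched FluxClosure / EntropyAdmissibility /
law-generic RelativeEnergyStability, the route header's TWO-LAYER PLAN): legitimate and foreseen, but its
fine-scale `t = 0` datum fails at every FIXED kinetic window for admissible clumpy `q` (weak density
typicality allows mesoscale clusters at scales `≫ ℓ_N`), so the windows must be chosen `q`-dependently
and the cut EOS coercivity is unprinted (why-might-fail of stmt-17653) — left to the line planner of (M),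
where it belongs (relative energy in QUENCHED EXPECTATION is a proof of (M)+(C) at once). The present
cut is the classical mean/fluctuation split of a law of large numbers, and on THIS crux it separates the
two questions the quenched setting actually poses: are frozen admissible positions harmless ON AVERAGE
(M), and is velocity randomness alone enough to SELF-AVERAGE the macrostate before the shock (C).
Precedent on this summit: `Cruxes/AprioriBoundsInBand/Lines/birth.lean` (SIZE × CONCENTRATION),
`Cruxes/FieldVarianceBound/Lines/birth.lean`.

HONESTY. (M) ∧ (C) is slightly STRONGER than X (by exactly the uniform-integrability lemma that makes
mean and in-probability limits agree; true here: Gaussian velocities at time 0, kinetic energy conserved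
on good orbits). Neither stub is the crux or the summit: BC3 probes `stub → QuenchedThermalHydro` and
`stub → _root_.HydrodynamicLimit` by `first | exact? | simpa | aesop` FAIL for both stubs (4/4; planner
folder `bc/`, raw outputs in NOTES.md `birth-certificate:`). Every item keeps X's ties verbatim: `ρ(0,·)`
is tied to the particle data (density typicality forces `∫ρ(0) = 1`), the packing guard is kept, all
conclusions live under `t ∈ Set.Ioo 0 T` (so `T > 0`, `Ico 0 T ≠ ∅`: the empty-horizon / non-measurable
datum corner of negative stmt-9395 cannot arise; negatives 9168/9236/9238 — untied `ρ(0)` — untouched).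

DISPROOF USED: none relevant — no `Cruxes/QuenchedThermalHydro/` directory existed at registration (no
`Disproof.lean`, no `_false_without_` theorem, no landed `Theorems/QuenchedThermalHydro/Negative/*`, no
prior line); dead lines: none recorded for this crux (the retired predecessor route KickedTypicalMicrostate
died at the EVERY-microstate form, which X already repairs by the velocity law; both stubs quantify the
same `P^q_N`-probability as X, never over individual velocity vectors).

Sources: Spohn1991 Part I Ch. 3, §7.1; OllaVaradhanYau1993 §1; BoldrighiniDobrushinSukhov1983 (hard rods:
Euler limit for individual configurations = mean + self-averaging); doi:10.1214/ejp.v15-728 (Euler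
hydrodynamics from deterministic configurations, random dynamics: the mirror image); Efron–Stein /
bounded differences: BoucheronLugosiMassart2013 Ch. 3; ChernovDolgopyat2009 (standard pairs seeded by
velocity randomness).
-/

noncomputable section

namespace Summit.AtomisticToContinuum.HydrodynamicLimit.Cruxes.QuenchedThermalHydro.Birth

open scoped BigOperators Topology ENNReal
open Filter Set MeasureTheory
open Literature.MathematicalPhysics.KineticTheory Literature.Analysis.FluidPDE
open Summit.AtomisticToContinuum.HydrodynamicLimit.Theses.KickedOrbits (QuenchedThermalHydro)

/-! ## §1 Registered stubs (bodies `sorry`; signatures over LANDED vocabulary only — `velMeasure`,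
`zipConfig` (`HardSphereEulerProofs`), `empiricalDensityField` / `…Momentum…` / `…Energy…`,
`totalEnergyDensity`, `IsHardSphereEulerSolution`, `hsDiameter` (`HardSphereEuler`), `HardSphereFlow`) -/

/-- STUB (M) `quenchedMeanHydro` — QUENCHED HYDRODYNAMICS IN THE MEAN (open, XL). X's frame verbatim;
conclusion: at every `t ∈ (0,T)` and for every continuous `χ`, the quenched MEANS of the tested density /
momentum / energy fields converge to the Euler values `∫χρ_t`, `∫(χρ_t)•u_t`, `∫χE(ρ_t,u_t,θ_t)`.
Why plausibly true: Bogolyubov's exact mean balance law + one-body (Maxwellian moments) and two-body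
(contact virial) closure in the quenched mean along the classical solution, the t = 0 means being explicit
functions of `q` (density typicality applied to `χ·u(0,·)`, `χ·(|u(0,·)|² + 3θ(0,·))/2`). Hardest stub. -/
theorem stub_quenchedMeanHydro :
    ∃ η₁ : ℝ, 0 < η₁ ∧ ∀ σ : ℝ, 0 < σ → ∀ (T : ℝ) (ρ θ : ℝ → T3 → ℝ) (u : ℝ → T3 → V3),
      IsHardSphereEulerSolution σ T ρ u θ → (∀ t ∈ Set.Ico 0 T, ∀ x, ρ t x * σ ^ 3 ≤ η₁) →
      ∀ Φ : (N : ℕ) → HardSphereFlow (Torus.geometry (Fin 3)) (hsDiameter σ N) (N + 1),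
      ∀ q : (N : ℕ) → (Fin (N + 1) → T3),
      (∀ N, ∀ᵐ v ∂(velMeasure (u 0) (θ 0) (q N)), zipConfig (q N, v) ∈ (Φ N).good) →
      (∀ χ : T3 → ℝ, Continuous χ →
        Tendsto (fun N : ℕ => ((N + 1 : ℕ) : ℝ)⁻¹ * ∑ i, χ (q N i)) atTop (𝓝 (∫ x, χ x * ρ 0 x))) →
      ∀ t ∈ Set.Ioo 0 T, ∀ χ : T3 → ℝ, Continuous χ →
        Tendsto (fun N : ℕ => ∫ z, empiricalDensityField ((Φ N).flow t z) χ
            ∂((velMeasure (u 0) (θ 0) (q N)).map (fun v => zipConfig (q N, v))))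
          atTop (𝓝 (∫ x, χ x * ρ t x)) ∧
        Tendsto (fun N : ℕ => ∫ z, empiricalMomentumField ((Φ N).flow t z) χ
            ∂((velMeasure (u 0) (θ 0) (q N)).map (fun v => zipConfig (q N, v))))
          atTop (𝓝 (∫ x, (χ x * ρ t x) • u t x)) ∧
        Tendsto (fun N : ℕ => ∫ z, empiricalEnergyField ((Φ N).flow t z) χ
            ∂((velMeasure (u 0) (θ 0) (q N)).map (fun v => zipConfig (q N, v))))
          atTop (𝓝 (∫ x, χ x * totalEnergyDensity (ρ t x) (u t x) (θ t x))) := by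
  sorry

/-- STUB (C) `quenchedSelfAveraging` — QUENCHED SELF-AVERAGING, PRE-SHOCK (open, XL). X's frame verbatim;
conclusion: at every `t ∈ (0,T)`, for every continuous `χ` and `δ > 0`, the quenched probability that a
tested field deviates from ITS OWN QUENCHED MEAN by more than `δ` tends to `0` (zero-variance law; no
limit identified). Why plausibly true: the macrostate at time `t` is a function of `N+1` independent
velocity draws; Efron–Stein reduces it to a vanishing one-velocity resampling influence, which is what
dispersing dynamics seeded by velocity randomness should give before the shock (standard pairs); at
`t = 0` it is the plain LLN for independent Gaussians (density part even deterministic). -/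
theorem stub_quenchedSelfAveraging :
    ∃ η₁ : ℝ, 0 < η₁ ∧ ∀ σ : ℝ, 0 < σ → ∀ (T : ℝ) (ρ θ : ℝ → T3 → ℝ) (u : ℝ → T3 → V3),
      IsHardSphereEulerSolution σ T ρ u θ → (∀ t ∈ Set.Ico 0 T, ∀ x, ρ t x * σ ^ 3 ≤ η₁) →
      ∀ Φ : (N : ℕ) → HardSphereFlow (Torus.geometry (Fin 3)) (hsDiameter σ N) (N + 1),
      ∀ q : (N : ℕ) → (Fin (N + 1) → T3),
      (∀ N, ∀ᵐ v ∂(velMeasure (u 0) (θ 0) (q N)), zipConfig (q N, v) ∈ (Φ N).good) →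
      (∀ χ : T3 → ℝ, Continuous χ →
        Tendsto (fun N : ℕ => ((N + 1 : ℕ) : ℝ)⁻¹ * ∑ i, χ (q N i)) atTop (𝓝 (∫ x, χ x * ρ 0 x))) →
      ∀ t ∈ Set.Ioo 0 T, ∀ χ : T3 → ℝ, Continuous χ → ∀ δ > (0 : ℝ),
        Tendsto (fun N : ℕ => ((velMeasure (u 0) (θ 0) (q N)).map (fun v => zipConfig (q N, v)))
            {z | δ < |empiricalDensityField ((Φ N).flow t z) χ -
              ∫ z', empiricalDensityField ((Φ N).flow t z') χ
                ∂((velMeasure (u 0) (θ 0) (q N)).map (fun v => zipConfig (q N, v)))|})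
          atTop (𝓝 0) ∧
        Tendsto (fun N : ℕ => ((velMeasure (u 0) (θ 0) (q N)).map (fun v => zipConfig (q N, v)))
            {z | δ < ‖empiricalMomentumField ((Φ N).flow t z) χ -
              ∫ z', empiricalMomentumField ((Φ N).flow t z') χ
                ∂((velMeasure (u 0) (θ 0) (q N)).map (fun v => zipConfig (q N, v)))‖})
          atTop (𝓝 0) ∧
        Tendsto (fun N : ℕ => ((velMeasure (u 0) (θ 0) (q N)).map (fun v => zipConfig (q N, v)))
            {z | δ < |empiricalEnergyField ((Φ N).flow t z) χ -
              ∫ z', empiricalEnergyField ((Φ N).flow t z') χ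
                ∂((velMeasure (u 0) (θ 0) (q N)).map (fun v => zipConfig (q N, v)))|})
          atTop (𝓝 0) := by
  sorry

/-! ## §2 The stub statements BY STUB NAME — the hypotheses of `QuenchedThermalHydro_of`

The skeleton audit (`#h21_check_skeleton`, run by `ledger skeleton check`) admits a `Prop` hypothesis of
the composing theorem only if its head constant is a registered obligation or is NAMED like a declared
stub; the aliases below carry each stub's statement under its stub name (`type_of%` the sorried theorem,
so alias and theorem cannot drift). `__Registered` is an implementation-detail namespace, so the audit's
stub report resolves `stub_…` to the sorried theorems of §1. Device of `Cruxes/ForwardMeanHydro/Lines/birth.lean`. -/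

namespace __Registered

/-- Statement of registered stub (M), keyed by its stub name. -/
abbrev stub_quenchedMeanHydro : Prop :=
  type_of% Summit.AtomisticToContinuum.HydrodynamicLimit.Cruxes.QuenchedThermalHydro.Birth.stub_quenchedMeanHydro

/-- Statement of registered stub (C), keyed by its stub name. -/
abbrev stub_quenchedSelfAveraging : Prop :=
  type_of% Summit.AtomisticToContinuum.HydrodynamicLimit.Cruxes.QuenchedThermalHydro.Birth.stub_quenchedSelfAveraging

end __Registered

/-! ## §3 Glue (sorry-free): centring + concentration ⇒ convergence in probability -/

/-- If deterministic centrings `c N → L` and the laws `P N` concentrate at `δ/2` around `c N`, then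
`P N {δ < ‖F N − L‖} → 0` (triangle inequality, eventually in `N`; squeeze in `ℝ≥0∞`). [folklore] -/
theorem tendsto_measure_norm_sub_of_centre {α : ℕ → Type*} [∀ N, MeasurableSpace (α N)]
    {E : Type*} [SeminormedAddCommGroup E]
    (P : (N : ℕ) → Measure (α N)) (F : (N : ℕ) → α N → E) (c : ℕ → E) (L : E) {δ : ℝ}
    (hδ : 0 < δ) (hc : Tendsto c atTop (𝓝 L))
    (hP : Tendsto (fun N => P N {z | δ / 2 < ‖F N z - c N‖}) atTop (𝓝 0)) :
    Tendsto (fun N => P N {z | δ < ‖F N z - L‖}) atTop (𝓝 0) := by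
  have hev : ∀ᶠ N in atTop, ‖c N - L‖ < δ / 2 :=
    (tendsto_iff_norm_sub_tendsto_zero.1 hc).eventually_lt_const (half_pos hδ)
  refine tendsto_of_tendsto_of_tendsto_of_le_of_le' tendsto_const_nhds hP
    (Eventually.of_forall fun _ => zero_le) ?_
  filter_upwards [hev] with N hN
  refine measure_mono fun z hz => ?_
  simp only [Set.mem_setOf_eq] at hz ⊢
  have h3 := norm_sub_le_norm_sub_add_norm_sub (F N z) (c N) L
  linarith

/-- Real-valued (absolute value) form of `tendsto_measure_norm_sub_of_centre`. [folklore] -/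
theorem tendsto_measure_abs_sub_of_centre {α : ℕ → Type*} [∀ N, MeasurableSpace (α N)]
    (P : (N : ℕ) → Measure (α N)) (F : (N : ℕ) → α N → ℝ) (c : ℕ → ℝ) (L : ℝ) {δ : ℝ}
    (hδ : 0 < δ) (hc : Tendsto c atTop (𝓝 L))
    (hP : Tendsto (fun N => P N {z | δ / 2 < |F N z - c N|}) atTop (𝓝 0)) :
    Tendsto (fun N => P N {z | δ < |F N z - L|}) atTop (𝓝 0) := by
  have hev : ∀ᶠ N in atTop, |c N - L| < δ / 2 := by
    have h0 : Tendsto (fun N => |c N - L|) atTop (𝓝 0) := by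
      simpa only [Real.norm_eq_abs] using tendsto_iff_norm_sub_tendsto_zero.1 hc
    exact h0.eventually_lt_const (half_pos hδ)
  refine tendsto_of_tendsto_of_tendsto_of_le_of_le' tendsto_const_nhds hP
    (Eventually.of_forall fun _ => zero_le) ?_
  filter_upwards [hev] with N hN
  refine measure_mono fun z hz => ?_
  simp only [Set.mem_setOf_eq] at hz ⊢
  have h3 := abs_sub_le (F N z) (c N) L
  linarith

/-! ## §4 The skeleton theorem -/

/-- **THE SKELETON THEOREM.** The two registered stubs — (M) quenched hydrodynamics in the mean and (C)
quenched self-averaging, as hypotheses BY STUB NAME — imply the crux decl `KickedOrbits.QuenchedThermalHydro`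
BY NAME: `η₁ := min η₁ᴹ η₁ᶜ` (guard monotone), then per test function and `δ`, centring at the quenched
mean: means → Euler value (M), concentration at `δ/2` (C), triangle inequality (§3). No `sorry` here. -/
theorem QuenchedThermalHydro_of (hM : __Registered.stub_quenchedMeanHydro)
    (hC : __Registered.stub_quenchedSelfAveraging) : QuenchedThermalHydro := by
  obtain ⟨ηM, hηM, HM⟩ :=
    (hM : type_of% Summit.AtomisticToContinuum.HydrodynamicLimit.Cruxes.QuenchedThermalHydro.Birth.stub_quenchedMeanHydro)
  obtain ⟨ηC, hηC, HC⟩ :=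
    (hC : type_of% Summit.AtomisticToContinuum.HydrodynamicLimit.Cruxes.QuenchedThermalHydro.Birth.stub_quenchedSelfAveraging)
  refine ⟨min ηM ηC, lt_min hηM hηC, ?_⟩
  intro σ hσ T ρ θ u hE hG Φ q hgood hdens t ht
  have hGM : ∀ s ∈ Set.Ico 0 T, ∀ x, ρ s x * σ ^ 3 ≤ ηM :=
    fun s hs x => (hG s hs x).trans (min_le_left _ _)
  have hGC : ∀ s ∈ Set.Ico 0 T, ∀ x, ρ s x * σ ^ 3 ≤ ηC :=
    fun s hs x => (hG s hs x).trans (min_le_right _ _)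
  unfold TendstoHydroFieldsAt
  intro χ hχ δ hδ
  obtain ⟨hM1, hM2, hM3⟩ := HM σ hσ T ρ θ u hE hGM Φ q hgood hdens t ht χ hχ
  obtain ⟨hC1, hC2, hC3⟩ := HC σ hσ T ρ θ u hE hGC Φ q hgood hdens t ht χ hχ (δ / 2) (half_pos hδ)
  refine ⟨?_, ?_, ?_⟩
  · exact tendsto_measure_abs_sub_of_centre
      (fun N => (velMeasure (u 0) (θ 0) (q N)).map (fun v => zipConfig (q N, v)))
      (fun N z => empiricalDensityField ((Φ N).flow t z) χ)
      (fun N => ∫ z, empiricalDensityField ((Φ N).flow t z) χ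
        ∂((velMeasure (u 0) (θ 0) (q N)).map (fun v => zipConfig (q N, v))))
      (∫ x, χ x * ρ t x) hδ hM1 hC1
  · exact tendsto_measure_norm_sub_of_centre
      (fun N => (velMeasure (u 0) (θ 0) (q N)).map (fun v => zipConfig (q N, v)))
      (fun N z => empiricalMomentumField ((Φ N).flow t z) χ)
      (fun N => ∫ z, empiricalMomentumField ((Φ N).flow t z) χ
        ∂((velMeasure (u 0) (θ 0) (q N)).map (fun v => zipConfig (q N, v))))
      (∫ x, (χ x * ρ t x) • u t x) hδ hM2 hC2
  · exact tendsto_measure_abs_sub_of_centre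
      (fun N => (velMeasure (u 0) (θ 0) (q N)).map (fun v => zipConfig (q N, v)))
      (fun N z => empiricalEnergyField ((Φ N).flow t z) χ)
      (fun N => ∫ z, empiricalEnergyField ((Φ N).flow t z) χ
        ∂((velMeasure (u 0) (θ 0) (q N)).map (fun v => zipConfig (q N, v))))
      (∫ x, χ x * totalEnergyDensity (ρ t x) (u t x) (θ t x)) hδ hM3 hC3

/-- D-0027 §3.3 shape: the crux from the two registered stubs (modulo exactly their two `sorry`s); also
certifies that the `__Registered` aliases ARE the stubs' statements, definitionally. -/
example : QuenchedThermalHydro :=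
  QuenchedThermalHydro_of stub_quenchedMeanHydro stub_quenchedSelfAveraging

end Summit.AtomisticToContinuum.HydrodynamicLimit.Cruxes.QuenchedThermalHydro.Birth

end
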